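import Mathlib
import Literature.MathematicalPhysics.QuantumLattice.ShellToGermMarkov
import HarnessLib

/-!
# `BallSpecification.BallSpecifiedFieldLimit` — stub `stub_germOfShellMarkov` (item stmt-CriticalPhenomena-11247), proved

THEOREM-ONLY file. Registered stub `stub_germOfShellMarkov` (S2c) of the line `registered`
(`Cruxes/BallSpecifiedFieldLimit/Lines/birth.lean`): FROM THICK SHELLS TO THE GERM — a probability law
`μ` on `𝓢'(ℝ³)` that is thick-shell Markov at `(c, r)` for every width `ε > 0` (the open-shell events
`extEvents (ball c (r + ε) ∖ closedBall c r)` split the interior events `extEvents (ball c r)` from the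
far-exterior events `extEvents (closedBall c (r + ε/2))ᶜ`, in the splitting form `CondIndepCondExp` of
`GermMarkov.lean`) has, for every interior event `A`, a `germEvents c r`-measurable version `g` of
`μ[A | extEvents (closedBall c r)ᶜ]`: `μ (A ∩ B) = ∫⁻_B g dμ` for all exterior events `B` — the
hypothesis of the landed kernel-version theorem `stub_properGermKernels`.

Proof: this is the Literature theorem
`Literature.MathematicalPhysics.QuantumLattice.exists_germMeasurable_version_of_shellSplitting`
(`Literature/MathematicalPhysics/QuantumLattice/ShellToGermMarkov.lean`, Rozanov 1982 Ch. 2 §1.3,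
(1.27) ⇒ (1.29), one-sided: smooth-cutoff decomposition
`extEvents (closedBall c r)ᶜ = extEvents (shell_ε) ⊔ extEvents (closedBall c (r + ε/2))ᶜ`, the π–λ
identity `μ⟦A | shell_ε ⊔ far⟧ = μ⟦A | shell_ε⟧` a.e. under splitting, and `g = limsup_n μ⟦A | shell_{1/(n+1)}⟧`)
specialised to `E = ℝ³`.
-/

noncomputable section

namespace Summit.CriticalPhenomena.Ising3DConformalLimit.Theorems

open MeasureTheory Literature.MathematicalPhysics.QuantumLattice

/-- **Registered stub `stub_germOfShellMarkov` (S2c · from thick shells to the germ), proved**: a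
probability law on `FieldConfig ℝ³` whose open-shell events `extEvents (ball c (r + ε) ∖ closedBall c r)`
split the interior events `extEvents (ball c r)` from the far-exterior events
`extEvents (closedBall c (r + ε/2))ᶜ` for EVERY `ε > 0` (`0 < r`) admits, for every interior event `A`, a
`germEvents c r`-measurable `g` with `μ (A ∩ B) = ∫⁻_B g dμ` for all `B ∈ extEvents (closedBall c r)ᶜ`
(Rozanov 1982, Ch. 2 §1.3, (1.27) ⇒ (1.29); Literature
`exists_germMeasurable_version_of_shellSplitting` at `E = ℝ³`). [cite: Rozanov1982, Ch. 2 §1.3 (1.29)] -/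
theorem stub_germOfShellMarkov :
    ∀ (μ : MeasureTheory.Measure (Literature.MathematicalPhysics.QuantumLattice.FieldConfig (EuclideanSpace ℝ (Fin 3)))),
      MeasureTheory.IsProbabilityMeasure μ →
      ∀ (c : EuclideanSpace ℝ (Fin 3)) (r : ℝ), 0 < r →
        (∀ ε : ℝ, 0 < ε →
          Literature.MathematicalPhysics.QuantumLattice.CondIndepCondExp
          (Literature.MathematicalPhysics.QuantumLattice.extEvents (Metric.ball c (r + ε) \ Metric.closedBall c r))
          (Literature.MathematicalPhysics.QuantumLattice.extEvents (Metric.ball c r))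
          (Literature.MathematicalPhysics.QuantumLattice.extEvents (Metric.closedBall c (r + ε / 2))ᶜ)
          μ) →
        ∀ A : Set (Literature.MathematicalPhysics.QuantumLattice.FieldConfig (EuclideanSpace ℝ (Fin 3))),
          MeasurableSet[Literature.MathematicalPhysics.QuantumLattice.extEvents (Metric.ball c r)] A →
          ∃ g : Literature.MathematicalPhysics.QuantumLattice.FieldConfig (EuclideanSpace ℝ (Fin 3)) → ENNReal,
            Measurable[Literature.MathematicalPhysics.QuantumLattice.germEvents c r] g ∧
            ∀ B : Set (Literature.MathematicalPhysics.QuantumLattice.FieldConfig (EuclideanSpace ℝ (Fin 3))),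
              MeasurableSet[Literature.MathematicalPhysics.QuantumLattice.extEvents (Metric.closedBall c r)ᶜ] B →
              μ (A ∩ B) = ∫⁻ η in B, g η ∂μ := by
  intro μ hμ c r hr hshell A hA
  exact exists_germMeasurable_version_of_shellSplitting μ c hr hshell hA

end Summit.CriticalPhenomena.Ising3DConformalLimit.Theorems

end
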